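import Summits.SmoothPoincare4.SmoothPoincare4.Theorems.ConvexBisectionAcyclicBisectionExistsDualDataChart
import Literature.Topology.FourManifolds.HandleAttachingMapsInversion
import Literature.Topology.FourManifolds.ClosedBallSmoothEmbeddings
import HarnessLib

/-!
# The dual multi-attachment data, II: the dual handle charts `F_j = Θ_j ∘ 𝓕` on the belt piece
(helper file 2 of the wave-5 brick T3b (iv) "the dual multi-attachment data `D₂` on the complement
piece `W₂`" for stub `stub_T3_dualPresentation` (T3), line `modp-braid-orbits`, crux
`ConvexBisection.AcyclicBisectionExists`, item stmt-SmoothPoincare4-10508; lead c5, worker X1)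

Sequel of `…DualDataChart.lean`.  The `j`-th dual handle chart of the complement piece is, as a map
into Milnor's gluing `M' = G.d₂.Glued`,

  `F̃ⱼ : D⁴ ∖ S → M'`, `F̃ⱼ b = Θ_{f j} (𝓕 b)` (`Θ` the glued handle chart, `𝓕 = modelF a κ δ`),

and, read on Kosinski's tube `T` through the inversion `α` (`handleInversionPH`), the tube piece
`K̃ⱼ y = F̃ⱼ (α y)` of the stretched `W`-piece `E`.

* §1 `F̃ⱼ` is an injective immersion and a topological embedding (restriction of the open embedding
  `Θ ∘ 𝓕` of the open set `Ω ∩ 𝓕⁻¹(chartDom a) ⊇ D⁴ ∖ S` of `ℝ⁴`, file I), with values in `{Φ ≤ 0}`,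
  and the charts of two suffix handles have disjoint images;
* §2 `K̃ⱼ` is an immersion off the attaching sphere, and **on the roof shell `‖y_λ‖² < 1/4` it IS the
  dual attaching map read in `M'`**: `K̃ⱼ y = j_N (dualMap … (f j) y)` (F-top `𝓕 ∘ α = dualVec` and
  V5's `jN_dualMap_eq_modelChart`);
* §3 **the range of `F̃ⱼ` is relatively open in `{Φ ≤ 0}`**: `range F̃ⱼ = Θ(O) ∩ {Φ ≤ 0}` for an
  explicit open `O ⊆ chartDom a`.

Everything here is proved; no named facts, no definitions.

## References
* J. Milnor, *Lectures on the h-cobordism theorem* (1965), §3 (dual handles). [MilnorHCobordism1965]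
* A. A. Kosinski, *Differential Manifolds* (1993), VI §6, (6.1). [Kosinski1993]
* J. M. Lee, *Introduction to Smooth Manifolds* (2013), Thm. 4.14, Prop. 5.22. [LeeSmoothManifolds2013]
-/

noncomputable section

-- the prescribed namespace `Summit.<P>.<Sub>.…` duplicates `SmoothPoincare4` (P = Sub)
set_option linter.dupNamespace false

open scoped Manifold ContDiff Topology

namespace Summit.SmoothPoincare4.SmoothPoincare4.Theorems.AcyclicBisectionExists.ModpBraidOrbits

open Set Function Metric Filter Topology
open Literature.Topology.FourManifolds Literature.Topology.FourManifolds.HandleAttachingMap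

section Handle

variable {B : Type} [TopologicalSpace B] [T2Space B] [ChartedSpace (EuclideanHalfSpace 4) B]
  {ι : Type} [Finite ι] {h : ι → HandleAttachingMap 3 2 B}
  {X : Type} [TopologicalSpace X] [ChartedSpace (EuclideanHalfSpace 4) X] [IsManifold (𝓡∂ 4) ∞ X]
  (D : MultiAttachmentData h (𝓡∂ 4) X) (i : ι) {bX : BoundaryData (𝓡∂ 4) X (𝓡 3)}
  {W : Type} [TopologicalSpace W] [ChartedSpace (EuclideanHalfSpace 4) W]
  [IsManifold (𝓡∂ 4) ∞ W] {bW : BoundaryData (𝓡∂ 4) W (𝓡 3)} [Nonempty bX.carrier]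
  (G : BoundaryGlueData bX bW) {a κ δ : ℝ}

/-! ### §1 The belt-piece map `F̃ⱼ b = Θ (𝓕 b)` -/

omit [Finite ι] in
/-- A belt-piece point, as a vector: `‖b‖ ≤ 1` and `‖b_λ‖² < 1`. [cite: Kosinski1993, VI §6] -/
theorem belt_coe_mem (b : ↥(beltPiece 3 2)) :
    ‖((b : closedBall (0 : EuclideanSpace ℝ (Fin 4)) 1) : EuclideanSpace ℝ (Fin 4))‖ ≤ 1 ∧
      sOf ((b : closedBall (0 : EuclideanSpace ℝ (Fin 4)) 1) : EuclideanSpace ℝ (Fin 4)) < 1 := by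
  have h1 : ‖((b : closedBall (0 : EuclideanSpace ℝ (Fin 4)) 1) : EuclideanSpace ℝ (Fin 4))‖ ≤ 1 :=
    mem_closedBall_zero_iff.1 b.1.2
  refine ⟨h1, ?_⟩
  rw [sOf_eq_lamSq]
  exact lt_of_le_of_ne (lamSq_le_one h1) b.2

/-- The vector map `D⁴ ∖ S → ℝ⁴` is a topological embedding. [folklore] -/
theorem isEmbedding_belt_coe :
    IsEmbedding fun b : ↥(beltPiece 3 2) => ((b : closedBall (0 : EuclideanSpace ℝ (Fin 4)) 1) : EuclideanSpace ℝ (Fin 4)) :=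
  IsEmbedding.subtypeVal.comp IsEmbedding.subtypeVal

variable [CompactSpace X] [T2Space X] [T2Space W]

/-- **`F̃ⱼ` is an immersion at every point of the belt piece** (the composite `Θ ∘ 𝓕` is an immersion of
an open neighbourhood of `D⁴ ∖ S` in `ℝ⁴`; immersions of `ℝ⁴` restrict to immersions of `D⁴`,
`isImmersionAtOfComplement_comp_coe_closedBall`, and of its open subset `D⁴ ∖ S`).
[cite: LeeSmoothManifolds2013, Prop. 5.22] -/
theorem isImmersionAt_handleMap (ha : 0 < a) (hCM : CollarAdapted D i G a) (hκ : 0 < κ) (hκ2 : κ ≤ 1 / 2)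
    (hδ : 0 < δ) (hδ2 : δ ≤ 1 / 2) (haδ : a * δ ≤ 1 / 5) (b : ↥(beltPiece 3 2)) :
    Manifold.IsImmersionAt (𝓡∂ 4) (𝓡 4) ∞
      (fun b : ↥(beltPiece 3 2) => gluedHandleChart D i G a
        (modelF a κ δ ((b : closedBall (0 : EuclideanSpace ℝ (Fin 4)) 1) : EuclideanSpace ℝ (Fin 4)))) b := by
  obtain ⟨hb1, hbs⟩ := belt_coe_mem b
  have h1 := (isImmersionAt_comp_modelF D i G ha hCM hκ hκ2 hδ hδ2
    (mem_compDom_of_norm_le_one ha hκ hκ2 hδ hδ2 haδ hb1 hbs)).isImmersionAtOfComplement_complement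
  have h2 := isImmersionAtOfComplement_comp_coe_closedBall (n := 3)
    (x := (b : closedBall (0 : EuclideanSpace ℝ (Fin 4)) 1)) h1
  exact (h2.comp_subtypeVal (beltPiece 3 2) (y := b)).isImmersionAt

/-- **`F̃ⱼ` is an immersion `(𝓡∂ 4) → (𝓡 4)`.** [cite: LeeSmoothManifolds2013, Prop. 5.22] -/
theorem isImmersion_handleMap (ha : 0 < a) (hCM : CollarAdapted D i G a) (hκ : 0 < κ) (hκ2 : κ ≤ 1 / 2)
    (hδ : 0 < δ) (hδ2 : δ ≤ 1 / 2) (haδ : a * δ ≤ 1 / 5) :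
    Manifold.IsImmersion (𝓡∂ 4) (𝓡 4) ∞
      (fun b : ↥(beltPiece 3 2) => gluedHandleChart D i G a
        (modelF a κ δ ((b : closedBall (0 : EuclideanSpace ℝ (Fin 4)) 1) : EuclideanSpace ℝ (Fin 4)))) :=
  Manifold.isImmersion_of_isImmersionAt_of_finrank_eq rfl fun b =>
    isImmersionAt_handleMap D i G ha hCM hκ hκ2 hδ hδ2 haδ b

omit [CompactSpace X] [T2Space X] [T2Space W] in
/-- **`F̃ⱼ` is injective.** [cite: MilnorHCobordism1965, §3] -/
theorem injective_handleMap (ha : 0 < a) (hCM : CollarAdapted D i G a) (hκ : 0 < κ) (hκ2 : κ ≤ 1 / 2)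
    (hδ : 0 < δ) (hδ2 : δ ≤ 1 / 2) (haδ : a * δ ≤ 1 / 5) :
    Injective (fun b : ↥(beltPiece 3 2) => gluedHandleChart D i G a
        (modelF a κ δ ((b : closedBall (0 : EuclideanSpace ℝ (Fin 4)) 1) : EuclideanSpace ℝ (Fin 4)))) := by
  intro b b' hbb
  have hb := belt_coe_mem b
  have hb' := belt_coe_mem b'
  have key : ((b : closedBall (0 : EuclideanSpace ℝ (Fin 4)) 1) : EuclideanSpace ℝ (Fin 4)) =
      ((b' : closedBall (0 : EuclideanSpace ℝ (Fin 4)) 1) : EuclideanSpace ℝ (Fin 4)) :=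
    injOn_comp_modelF D i G ha hCM hκ hκ2 hδ hδ2 (mem_compDom_of_norm_le_one ha hκ hκ2 hδ hδ2 haδ hb.1 hb.2)
      (mem_compDom_of_norm_le_one ha hκ hκ2 hδ hδ2 haδ hb'.1 hb'.2) hbb
  apply Subtype.ext
  apply Subtype.ext
  exact key

/-- **`F̃ⱼ` is a topological embedding**: the composite `Θ ∘ 𝓕` restricted to the open set
`Ω ∩ 𝓕⁻¹(chartDom a)` of `ℝ⁴` is an open embedding (continuous, injective, open), and `F̃ⱼ` is its
restriction to the subspace `D⁴ ∖ S`. [cite: LeeSmoothManifolds2013, Thm. 4.14] -/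
theorem isEmbedding_handleMap (ha : 0 < a) (hCM : CollarAdapted D i G a) (hκ : 0 < κ) (hκ2 : κ ≤ 1 / 2)
    (hδ : 0 < δ) (hδ2 : δ ≤ 1 / 2) (haδ : a * δ ≤ 1 / 5) :
    IsEmbedding (fun b : ↥(beltPiece 3 2) => gluedHandleChart D i G a
        (modelF a κ δ ((b : closedBall (0 : EuclideanSpace ℝ (Fin 4)) 1) : EuclideanSpace ℝ (Fin 4)))) := by
  have hVo := isOpen_compDom a hκ hκ2 hδ hδ2 ha
  let VO : TopologicalSpace.Opens (EuclideanSpace ℝ (Fin 4)) := ⟨_, hVo⟩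
  have hVmem : ∀ z : VO, (z : EuclideanSpace ℝ (Fin 4)) ∈
      {z : EuclideanSpace ℝ (Fin 4) | sOf z < 1 ∧ uOf z < 1 + 1 / (2 * (a + 1))} ∩ modelF a κ δ ⁻¹' chartDom a :=
    fun z => z.2
  have hc : Continuous fun z : VO => gluedHandleChart D i G a (modelF a κ δ z) :=
    (contMDiffOn_comp_modelF D i G ha hCM hκ hκ2 hδ hδ2).continuousOn.comp_continuous continuous_subtype_val hVmem
  have hinj : Injective fun z : VO => gluedHandleChart D i G a (modelF a κ δ z) := fun z z' hzz =>
    Subtype.ext (injOn_comp_modelF D i G ha hCM hκ hκ2 hδ hδ2 (hVmem z) (hVmem z') hzz)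
  have hopen : IsOpenMap fun z : VO => gluedHandleChart D i G a (modelF a κ δ z) := by
    intro O hO
    obtain ⟨O', hO', rfl⟩ := isOpen_induced_iff.1 hO
    have heq : (fun z : VO => gluedHandleChart D i G a (modelF a κ δ z)) '' (Subtype.val ⁻¹' O') =
        (fun z => gluedHandleChart D i G a (modelF a κ δ z)) '' (O' ∩ (VO : Set (EuclideanSpace ℝ (Fin 4)))) := by
      ext p
      simp only [mem_image, mem_preimage, mem_inter_iff]
      constructor
      · rintro ⟨z, hz, rfl⟩
        exact ⟨z.1, ⟨hz, z.2⟩, rfl⟩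
      · rintro ⟨y, ⟨hy, hyV⟩, rfl⟩
        exact ⟨⟨y, hyV⟩, hy, rfl⟩
    rw [heq]
    exact isOpen_image_comp_modelF D i G ha hCM hκ hκ2 hδ hδ2 (hO'.inter hVo) inter_subset_right
  have hk : IsOpenEmbedding fun z : VO => gluedHandleChart D i G a (modelF a κ δ z) :=
    IsOpenEmbedding.of_continuous_injective_isOpenMap hc hinj hopen
  have hmem : ∀ b : ↥(beltPiece 3 2),
      ((b : closedBall (0 : EuclideanSpace ℝ (Fin 4)) 1) : EuclideanSpace ℝ (Fin 4)) ∈ (VO : Set (EuclideanSpace ℝ (Fin 4))) :=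
    fun b => mem_compDom_of_norm_le_one ha hκ hκ2 hδ hδ2 haδ (belt_coe_mem b).1 (belt_coe_mem b).2
  have hι : IsEmbedding fun b : ↥(beltPiece 3 2) =>
      (⟨((b : closedBall (0 : EuclideanSpace ℝ (Fin 4)) 1) : EuclideanSpace ℝ (Fin 4)), hmem b⟩ : VO) :=
    isEmbedding_belt_coe.codRestrict _ hmem
  have hcomp := hk.isEmbedding.comp hι
  exact hcomp

omit [CompactSpace X] [T2Space X] [T2Space W] in
/-- **`F̃ⱼ` takes values in the complement piece `{Φ ≤ 0}`** (file I, `levelFn_gluedHandleChart_nonpos`).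
[cite: Milnor1963, Thm. 3.1] -/
theorem levelFn_handleMap_nonpos [CompactSpace X] [T2Space X] [T2Space W] [CompactSpace W]
    {ι' : Type} (f : ι' → ι) (ha : 0 < a) (hf : Injective f) (hCM : ∀ j, CollarAdapted D (f j) G a)
    (hκ : 0 < κ) (hκ2 : κ ≤ 1 / 2) (hκ1 : κ ≤ 1) (hδ : 0 < δ) (hδ2 : δ ≤ 1 / 2) (haδ : a * δ ≤ 1 / 5)
    (col : (BoundaryManifold.boundaryData 3 W).Collar)
    (hcol : ∀ (w : (BoundaryManifold.boundaryData 3 W).carrier) (x : bW.carrier),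
      (BoundaryManifold.boundaryData 3 W).incl w = bW.incl x →
      ∀ t : Set.Icc (0 : ℝ) 1, col.toFun (w, t) = G.CN.toFun x ((t : ℝ) / (2 - t)))
    (j : ι') (b : ↥(beltPiece 3 2)) :
    levelFn D f G a κ δ (gluedHandleChart D (f j) G a
      (modelF a κ δ ((b : closedBall (0 : EuclideanSpace ℝ (Fin 4)) 1) : EuclideanSpace ℝ (Fin 4)))) ≤ 0 :=
  levelFn_gluedHandleChart_nonpos D f G ha hf hCM hκ hκ2 hκ1 hδ hδ2 col hcol j
    (modelF_mem_chartDom ha hκ hκ2 hδ hδ2 haδ (belt_coe_mem b).1 (belt_coe_mem b).2).1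

omit [CompactSpace X] [T2Space X] [T2Space W] in
/-- **The dual handle charts of two different handles have disjoint images** (Y6 `gluedHandleChart_ne`).
[cite: Kosinski1993, VI §6] -/
theorem handleMap_ne (ha : 0 < a) {i' : ι} (hii' : i ≠ i') (hCM : CollarAdapted D i G a) (hCM' : CollarAdapted D i' G a)
    (hκ : 0 < κ) (hκ2 : κ ≤ 1 / 2) (hδ : 0 < δ) (hδ2 : δ ≤ 1 / 2) (haδ : a * δ ≤ 1 / 5) (b b' : ↥(beltPiece 3 2)) :
    gluedHandleChart D i G a (modelF a κ δ ((b : closedBall (0 : EuclideanSpace ℝ (Fin 4)) 1) : EuclideanSpace ℝ (Fin 4))) ≠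
      gluedHandleChart D i' G a (modelF a κ δ ((b' : closedBall (0 : EuclideanSpace ℝ (Fin 4)) 1) : EuclideanSpace ℝ (Fin 4))) :=
  gluedHandleChart_ne D G ha hii' hCM hCM'
    (modelF_mem_chartDom ha hκ hκ2 hδ hδ2 haδ (belt_coe_mem b).1 (belt_coe_mem b).2).2
    (modelF_mem_chartDom ha hκ hκ2 hδ hδ2 haδ (belt_coe_mem b').1 (belt_coe_mem b').2).2

/-! ### §2 The tube piece `K̃ⱼ y = F̃ⱼ (α y)` -/

omit [Finite ι] in
/-- A tube point off the attaching sphere, as a vector: `α y ∈ D⁴`, `‖(α y)_λ‖² = 1 - ‖y_λ‖² < 1`,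
`3/4 < ‖(α y)_λ‖²` as soon as `‖y_λ‖² < 1/4`. [cite: Kosinski1993, VI (6.1)] -/
theorem tube_inv_mem (y : ↥(handleTube 3 2)) (hy : lamSq 2 (((y : closedBall (0 : EuclideanSpace ℝ (Fin 4)) 1) : EuclideanSpace ℝ (Fin 4))) ≠ 1) :
    ‖handleInversion 2 (((y : closedBall (0 : EuclideanSpace ℝ (Fin 4)) 1) : EuclideanSpace ℝ (Fin 4)))‖ ≤ 1 ∧
      lamSq 2 (handleInversion 2 (((y : closedBall (0 : EuclideanSpace ℝ (Fin 4)) 1) : EuclideanSpace ℝ (Fin 4)))) =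
        1 - lamSq 2 (((y : closedBall (0 : EuclideanSpace ℝ (Fin 4)) 1) : EuclideanSpace ℝ (Fin 4))) ∧
      0 < lamSq 2 (((y : closedBall (0 : EuclideanSpace ℝ (Fin 4)) 1) : EuclideanSpace ℝ (Fin 4))) ∧
      lamSq 2 (((y : closedBall (0 : EuclideanSpace ℝ (Fin 4)) 1) : EuclideanSpace ℝ (Fin 4))) < 1 := by
  have h1 : ‖((y : closedBall (0 : EuclideanSpace ℝ (Fin 4)) 1) : EuclideanSpace ℝ (Fin 4))‖ ≤ 1 :=
    mem_closedBall_zero_iff.1 y.1.2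
  have h0 : 0 < lamSq 2 (((y : closedBall (0 : EuclideanSpace ℝ (Fin 4)) 1) : EuclideanSpace ℝ (Fin 4))) :=
    lt_of_le_of_ne (lamSq_nonneg 2 _) (Ne.symm y.2)
  have hl1 : lamSq 2 (((y : closedBall (0 : EuclideanSpace ℝ (Fin 4)) 1) : EuclideanSpace ℝ (Fin 4))) < 1 :=
    lt_of_le_of_ne (lamSq_le_one h1) hy
  exact ⟨norm_handleInversion_le_one h1 h0 hl1, lamSq_handleInversion h0 hl1.le, h0, hl1⟩

/-- **The tube piece `K̃ⱼ` is an immersion at every point off the attaching sphere** (`α` is a partial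
diffeomorphism `T ∖ S ⇀ D⁴ ∖ S`, `handleInversionPH`, and `F̃ⱼ` an immersion).
[cite: LeeSmoothManifolds2013, Prop. 5.22] -/
theorem isImmersionAt_tubeMap (ha : 0 < a) (hCM : CollarAdapted D i G a) (hκ : 0 < κ) (hκ2 : κ ≤ 1 / 2)
    (hδ : 0 < δ) (hδ2 : δ ≤ 1 / 2) (haδ : a * δ ≤ 1 / 5) (y : ↥(handleTube 3 2))
    (hy : lamSq 2 (((y : closedBall (0 : EuclideanSpace ℝ (Fin 4)) 1) : EuclideanSpace ℝ (Fin 4))) ≠ 1) :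
    Manifold.IsImmersionAt (𝓡∂ 4) (𝓡 4) ∞
      (fun y : ↥(handleTube 3 2) => gluedHandleChart D i G a (modelF a κ δ
        (handleInversion 2 (((y : closedBall (0 : EuclideanSpace ℝ (Fin 4)) 1) : EuclideanSpace ℝ (Fin 4)))))) y := by
  haveI : Nonempty ↥(handleTube 3 2) := ⟨y⟩
  set P := handleInversionPH 3 2 with hP
  have hΦ : ContMDiffOn (𝓡∂ 4) (𝓡∂ 4) ∞ P.symm P.symm.source := contMDiffOn_handleInversionPH_symm 3 2
  have hΦ' : ContMDiffOn (𝓡∂ 4) (𝓡∂ 4) ∞ P.symm.symm P.symm.target := by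
    rw [OpenPartialHomeomorph.symm_symm, OpenPartialHomeomorph.symm_target]
    exact contMDiffOn_handleInversionPH 3 2
  have hsrc : y ∈ P.symm.source := by
    rw [OpenPartialHomeomorph.symm_source, hP, handleInversionPH_target]; exact hy
  have h1 := (isImmersionAt_handleMap D i G ha hCM hκ hκ2 hδ hδ2 haδ (P.symm y)).isImmersionAtOfComplement_complement
  exact (h1.comp_openPartialHomeomorph P.symm hΦ hΦ' hsrc).isImmersionAt

omit [CompactSpace X] [T2Space X] [T2Space W] in
/-- **On the roof shell `K̃ⱼ` IS the dual attaching map**: for `y ∈ T` with `‖y_λ‖² < 1/4`,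
`Θ (𝓕 (α y)) = j_N (dualMap … y)` (F-top: `𝓕 (α y) = dualVec (α (α y)) = dualVec y`; the glued chart
at a dual vector is `j_N` of the dual map). [cite: MilnorHCobordism1965, §3] -/
theorem tubeMap_eq_jN_of_lt (ha : 0 < a) (hκ : 0 < κ) (hκ1 : κ ≤ 1) (hδ : 0 < δ) (hδ2 : δ ≤ 1 / 2)
    (col : (BoundaryManifold.boundaryData 3 W).Collar)
    (hcol : ∀ (w : (BoundaryManifold.boundaryData 3 W).carrier) (x : bW.carrier),
      (BoundaryManifold.boundaryData 3 W).incl w = bW.incl x →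
      ∀ t : Set.Icc (0 : ℝ) 1, col.toFun (w, t) = G.CN.toFun x ((t : ℝ) / (2 - t)))
    (y : ↥(handleTube 3 2))
    (hy : lamSq 2 (((y : closedBall (0 : EuclideanSpace ℝ (Fin 4)) 1) : EuclideanSpace ℝ (Fin 4))) < 1 / 4) :
    gluedHandleChart D i G a (modelF a κ δ
        (handleInversion 2 (((y : closedBall (0 : EuclideanSpace ℝ (Fin 4)) 1) : EuclideanSpace ℝ (Fin 4))))) =
      G.jN ((dualMap D bX bW G.φ col κ δ hκ hκ1 hδ hδ2 i).toFun y) := by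
  obtain ⟨hx1, hxs, h0, -⟩ := tube_inv_mem y (by linarith)
  set x := handleInversion 2 (((y : closedBall (0 : EuclideanSpace ℝ (Fin 4)) 1) : EuclideanSpace ℝ (Fin 4))) with hx
  have hs : 3 / 4 < lamSq 2 x := by rw [hxs]; linarith
  have hs1 : lamSq 2 x < 1 := by rw [hxs]; linarith
  rw [modelF_eq_dualVec_handleInversion hκ x hx1 hs hs1]
  have hyy : handleInversionPt (⟨x, mem_closedBall_zero_iff.2 hx1⟩ : closedBall (0 : EuclideanSpace ℝ (Fin 4)) 1)
      (by show lamSq 2 x ≠ 0; linarith) (by show lamSq 2 x ≠ 1; exact ne_of_lt hs1) = y := by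
    apply Subtype.ext; apply Subtype.ext
    rw [coe_coe_handleInversionPt]
    exact handleInversion_handleInversion h0 (by linarith)
  rw [hyy, gluedHandleChart_dualVec D i G ha hκ hκ1 hδ hδ2 col hcol y]

/-! ### §3 The range of `F̃ⱼ` is relatively open in `{Φ ≤ 0}`; the lifted chart `F_j` -/

/-- The depth profile `y ↦ g a (δ (1 - ‖y_λ‖²/κ²))` is continuous on `ℝ⁴` (`δ ≤ 1/2` keeps the argument
below `1`). [folklore] -/
theorem continuous_domeProfile (a : ℝ) (hκ : 0 < κ) (hδ : 0 ≤ δ) (hδ2 : δ ≤ 1 / 2) :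
    Continuous fun y : EuclideanSpace ℝ (Fin 4) => gProfile a (δ * (1 - ‖lamPart y‖ ^ 2 / κ ^ 2)) := by
  have hP : Continuous fun y : EuclideanSpace ℝ (Fin 4) => ‖lamPart y‖ ^ 2 := (contDiff_lamPart.continuous.norm).pow 2
  have ht : Continuous fun y : EuclideanSpace ℝ (Fin 4) => δ * (1 - ‖lamPart y‖ ^ 2 / κ ^ 2) :=
    continuous_const.mul (continuous_const.sub (hP.div_const _))
  unfold gProfile
  refine (continuous_const.mul ht).div (continuous_const.mul (continuous_const.sub ht)) fun y => ?_
  have h0 : 0 ≤ ‖lamPart y‖ ^ 2 / κ ^ 2 := by positivity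
  have : δ * (1 - ‖lamPart y‖ ^ 2 / κ ^ 2) ≤ 1 / 2 := by nlinarith
  exact mul_ne_zero two_ne_zero (by linarith)

/-- The open set `O = chartDom a ∩ (B⁴ ∪ {‖y_λ‖² < κ², ‖y‖² < 1 + g a (δ (1 - ‖y_λ‖²/κ²))})` is open. [folklore] -/
theorem isOpen_rangeSet (a : ℝ) (hκ : 0 < κ) (hδ : 0 ≤ δ) (hδ2 : δ ≤ 1 / 2) :
    IsOpen (chartDom a ∩ (ball (0 : EuclideanSpace ℝ (Fin 4)) 1 ∪
      {y : EuclideanSpace ℝ (Fin 4) | ‖lamPart y‖ ^ 2 < κ ^ 2 ∧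
        ‖y‖ ^ 2 < 1 + gProfile a (δ * (1 - ‖lamPart y‖ ^ 2 / κ ^ 2))})) := by
  have hP : Continuous fun y : EuclideanSpace ℝ (Fin 4) => ‖lamPart y‖ ^ 2 := (contDiff_lamPart.continuous.norm).pow 2
  refine (isOpen_chartDom a).inter (isOpen_ball.union ((isOpen_lt hP continuous_const).inter ?_))
  exact isOpen_lt (continuous_norm.pow 2) (continuous_const.add (continuous_domeProfile a hκ hδ hδ2))

omit [CompactSpace X] [T2Space X] [T2Space W] in
/-- **The range of `F̃ⱼ` is `Θ(O) ∩ {Φ ≤ 0}`**: `Dome ∪ N ⊆ O`, and conversely a point of `Θ(O)` in the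
complement piece comes from `N` (ball points with `H ≤ 0`, Y6's sign lemma) or from the dome.
[cite: Milnor1963, Thm. 3.1] -/
theorem range_handleMap_eq [CompactSpace X] [T2Space X] [T2Space W] [CompactSpace W]
    {ι' : Type} (f : ι' → ι) (ha : 0 < a) (hf : Injective f) (hCM : ∀ j, CollarAdapted D (f j) G a)
    (hκ : 0 < κ) (hκ2 : κ ≤ 1 / 2) (hκ1 : κ ≤ 1) (hδ : 0 < δ) (hδ2 : δ ≤ 1 / 2) (haδ : a * δ ≤ 1 / 5)
    (col : (BoundaryManifold.boundaryData 3 W).Collar)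
    (hcol : ∀ (w : (BoundaryManifold.boundaryData 3 W).carrier) (x : bW.carrier),
      (BoundaryManifold.boundaryData 3 W).incl w = bW.incl x →
      ∀ t : Set.Icc (0 : ℝ) 1, col.toFun (w, t) = G.CN.toFun x ((t : ℝ) / (2 - t)))
    (j : ι') :
    range (fun b : ↥(beltPiece 3 2) => gluedHandleChart D (f j) G a
        (modelF a κ δ ((b : closedBall (0 : EuclideanSpace ℝ (Fin 4)) 1) : EuclideanSpace ℝ (Fin 4)))) =
      gluedHandleChart D (f j) G a '' (chartDom a ∩ (ball (0 : EuclideanSpace ℝ (Fin 4)) 1 ∪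
        {y : EuclideanSpace ℝ (Fin 4) | ‖lamPart y‖ ^ 2 < κ ^ 2 ∧
          ‖y‖ ^ 2 < 1 + gProfile a (δ * (1 - ‖lamPart y‖ ^ 2 / κ ^ 2))})) ∩
        {p | levelFn D f G a κ δ p ≤ 0} := by
  apply Subset.antisymm
  · rintro _ ⟨b, rfl⟩
    obtain ⟨hb1, hbs⟩ := belt_coe_mem b
    obtain ⟨hx, hxV⟩ := modelF_mem_chartDom ha hκ hκ2 hδ hδ2 haδ hb1 hbs
    refine ⟨⟨_, ⟨hxV, ?_⟩, rfl⟩, levelFn_handleMap_nonpos D G f ha hf hCM hκ hκ2 hκ1 hδ hδ2 haδ col hcol j b⟩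
    set x := modelF a κ δ ((b : closedBall (0 : EuclideanSpace ℝ (Fin 4)) 1) : EuclideanSpace ℝ (Fin 4)) with hxd
    by_cases h1 : 1 ≤ ‖x‖
    · obtain ⟨y, hy⟩ := exists_dualVec_eq_of_one_le_norm ha hκ hκ2 hδ hδ2 hx h1
      have hD := dualVec_mem_dualDome ha hκ hκ1 hδ hδ2 y
      rw [hy] at hD
      exact Or.inr ⟨hD.1, hD.2.2⟩
    · exact Or.inl (mem_ball_zero_iff.2 (not_le.1 h1))
  · rintro p ⟨⟨y, ⟨hyV, hyO⟩, rfl⟩, hΦ⟩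
    have hmem : y ∈ dualDome a κ δ ∪ cocoreNbhd κ δ := by
      by_cases h1 : ‖y‖ < 1
      · right
        have hle : levelFn D f G a κ δ (G.jM (D.jB (f j) (beltBallPt y))) ≤ 0 := by
          rwa [gluedHandleChart_of_norm_lt_one D (f j) G a h1] at hΦ
        rw [levelFn_jM_jB_nonpos_iff D f G ha hf hCM hκ hκ2 hδ hδ2, coe_beltBallPt h1] at hle
        exact mem_cocoreNbhd_of_modelH_nonpos hκ hκ2 hδ hδ2 h1 (hle.resolve_right h1.ne)
      · left
        have hy2 := hyO.resolve_left fun h' => h1 (mem_ball_zero_iff.1 h')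
        exact ⟨hy2.1, by nlinarith [not_lt.1 h1, norm_nonneg y], hy2.2⟩
    rw [← image_modelF_eq ha hκ hκ2 hδ hδ2] at hmem
    obtain ⟨z, ⟨hz1, hzs⟩, rfl⟩ := hmem
    have hzl : lamSq 2 z ≠ 1 := by rw [← sOf_eq_lamSq]; exact hzs.ne
    exact ⟨⟨⟨z, mem_closedBall_zero_iff.2 hz1⟩, hzl⟩, rfl⟩

omit [CompactSpace X] [T2Space X] [T2Space W] in
/-- **THE DUAL HANDLE CHART `F_j : D⁴ ∖ S → W₂ = {Φ ≤ 0}`** (the lift of `F̃ⱼ`) **is a smooth embedding of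
manifolds with boundary with open range.** [cite: MilnorHCobordism1965, §3] -/
theorem isSmoothEmbedding_handleLift [CompactSpace X] [T2Space X] [T2Space W] [CompactSpace W]
    {ι' : Type} (f : ι' → ι) (ha : 0 < a) (hf : Injective f) (hCM : ∀ j, CollarAdapted D (f j) G a)
    (hκ : 0 < κ) (hκ2 : κ ≤ 1 / 2) (hκ1 : κ ≤ 1) (hδ : 0 < δ) (hδ2 : δ ≤ 1 / 2) (haδ : a * δ ≤ 1 / 5)
    (col : (BoundaryManifold.boundaryData 3 W).Collar)
    (hcol : ∀ (w : (BoundaryManifold.boundaryData 3 W).carrier) (x : bW.carrier),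
      (BoundaryManifold.boundaryData 3 W).incl w = bW.incl x →
      ∀ t : Set.Icc (0 : ℝ) 1, col.toFun (w, t) = G.CN.toFun x ((t : ℝ) / (2 - t)))
    (hΦ : IsRegularLevel (𝓡 4) (levelFn D f G a κ δ) 0) (j : ι') :
    Manifold.IsSmoothEmbedding (𝓡∂ 4) (𝓡∂ 4) ∞ (fun b : ↥(beltPiece 3 2) => RegularSublevel.mk hΦ
      (gluedHandleChart D (f j) G a (modelF a κ δ ((b : closedBall (0 : EuclideanSpace ℝ (Fin 4)) 1) : EuclideanSpace ℝ (Fin 4))))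
      (levelFn_handleMap_nonpos D G f ha hf hCM hκ hκ2 hκ1 hδ hδ2 haδ col hcol j b)) ∧
    IsOpen (range fun b : ↥(beltPiece 3 2) => RegularSublevel.mk hΦ
      (gluedHandleChart D (f j) G a (modelF a κ δ ((b : closedBall (0 : EuclideanSpace ℝ (Fin 4)) 1) : EuclideanSpace ℝ (Fin 4))))
      (levelFn_handleMap_nonpos D G f ha hf hCM hκ hκ2 hκ1 hδ hδ2 haδ col hcol j b)) := by
  haveI : Nonempty ↥(beltPiece 3 2) := ⟨handleCentrePt⟩
  have hopen : IsOpen (range fun b : ↥(beltPiece 3 2) => RegularSublevel.mk hΦ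
      (gluedHandleChart D (f j) G a (modelF a κ δ ((b : closedBall (0 : EuclideanSpace ℝ (Fin 4)) 1) : EuclideanSpace ℝ (Fin 4))))
      (levelFn_handleMap_nonpos D G f ha hf hCM hκ hκ2 hκ1 hδ hδ2 haδ col hcol j b)) := by
    have hR := range_handleMap_eq D G f ha hf hCM hκ hκ2 hκ1 hδ hδ2 haδ col hcol j
    have heq : (range fun b : ↥(beltPiece 3 2) => RegularSublevel.mk hΦ
        (gluedHandleChart D (f j) G a (modelF a κ δ ((b : closedBall (0 : EuclideanSpace ℝ (Fin 4)) 1) : EuclideanSpace ℝ (Fin 4))))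
        (levelFn_handleMap_nonpos D G f ha hf hCM hκ hκ2 hκ1 hδ hδ2 haδ col hcol j b)) =
        RegularSublevel.incl hΦ ⁻¹' (gluedHandleChart D (f j) G a '' (chartDom a ∩ (ball (0 : EuclideanSpace ℝ (Fin 4)) 1 ∪
          {y : EuclideanSpace ℝ (Fin 4) | ‖lamPart y‖ ^ 2 < κ ^ 2 ∧
            ‖y‖ ^ 2 < 1 + gProfile a (δ * (1 - ‖lamPart y‖ ^ 2 / κ ^ 2))}))) := by
      ext p
      constructor
      · rintro ⟨b, rfl⟩
        exact (hR.le ⟨b, rfl⟩).1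
      · intro hp
        obtain ⟨b, hb⟩ := hR.ge ⟨hp, RegularSublevel.apply_incl_le hΦ p⟩
        exact ⟨b, RegularSublevel.injective_incl hΦ hb⟩
    rw [heq]
    exact (isOpen_image_gluedHandleChart D (f j) G ha (hCM j) (isOpen_rangeSet a hκ hδ.le hδ2) inter_subset_left).preimage
      (RegularSublevel.continuous_incl hΦ)
  exact ⟨isSmoothEmbedding_sublevel_lift hΦ (isImmersion_handleMap D (f j) G ha (hCM j) hκ hκ2 hδ hδ2 haδ)
    (isEmbedding_handleMap D (f j) G ha (hCM j) hκ hκ2 hδ hδ2 haδ) _ hopen, hopen⟩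

end Handle

/-- **Registered helper `helper_dualHandleMap_embedding` (brick T3b (iv), sub-goal of
`stub_T3_dualPresentation`, wave 5, lead c5): the `i`-th dual handle chart `b ↦ Θᵢ (𝓕 b)` of Milnor's
gluing — glued handle chart after the model dual handle map — is an injective immersion of the belt
piece `D⁴ ∖ S` and a topological embedding** (it lifts to the smooth embedding `F_i : D⁴ ∖ S → W₂` with
open range, `isSmoothEmbedding_handleLift`). [cite: MilnorHCobordism1965, §3] -/
theorem helper_dualHandleMap_embedding : ∀ {B : Type} [TopologicalSpace B] [T2Space B] [ChartedSpace (EuclideanHalfSpace 4) B] {ι : Type} [Finite ι] {h : ι → Literature.Topology.FourManifolds.HandleAttachingMap 3 2 B} {X : Type} [TopologicalSpace X] [ChartedSpace (EuclideanHalfSpace 4) X] [IsManifold (𝓡∂ 4) ∞ X] (D : Literature.Topology.FourManifolds.HandleAttachingMap.MultiAttachmentData h (𝓡∂ 4) X) (i : ι) {bX : Literature.Topology.FourManifolds.BoundaryData (𝓡∂ 4) X (𝓡 3)} {W : Type} [TopologicalSpace W] [ChartedSpace (EuclideanHalfSpace 4) W] [IsManifold (𝓡∂ 4) ∞ W] {bW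 : Literature.Topology.FourManifolds.BoundaryData (𝓡∂ 4) W (𝓡 3)} [Nonempty bX.carrier] (G : Literature.Topology.FourManifolds.BoundaryGlueData bX bW) {a κ δ : ℝ} [CompactSpace X] [T2Space X] [T2Space W], 0 < a → Summit.SmoothPoincare4.SmoothPoincare4.Theorems.AcyclicBisectionExists.ModpBraidOrbits.CollarAdapted D i G a → 0 < κ → κ ≤ 1 / 2 → 0 < δ → δ ≤ 1 / 2 → a * δ ≤ 1 / 5 → Manifold.IsImmersion (𝓡∂ 4) (𝓡 4) ∞ (fun b : ↥(Literature.Topology.FourManifolds.beltPiece 3 2) => Summit.SmoothPoincare4.SmoothPoincare4.Theorems.AcyclicBisectionExists.ModpBraidOrbits.gluedHandleChart D i G a (Summit.SmoothPoincare4.SmoothPoincare4.Theorems.AcyclicBisectionExists.ModpBraidOrbits.modelF a κ δ ((b : Metric.closedBall (0 : EuclideanSpace ℝ (Fin 4)) 1) : EuclideanSpace ℝ (Fin 4)))) ∧ Topology.IsEmbedding (fun b : ↥(Literature.Topology.FourManifolds.beltPiece 3 2) => Summit.SmoothPoincare4.SmoothPoincare4.Theorems.AcyclicBisectionExists.ModpBraidOrbits.gluedHandleChart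 D i G a (Summit.SmoothPoincare4.SmoothPoincare4.Theorems.AcyclicBisectionExists.ModpBraidOrbits.modelF a κ δ ((b : Metric.closedBall (0 : EuclideanSpace ℝ (Fin 4)) 1) : EuclideanSpace ℝ (Fin 4)))) ∧ Function.Injective (fun b : ↥(Literature.Topology.FourManifolds.beltPiece 3 2) => Summit.SmoothPoincare4.SmoothPoincare4.Theorems.AcyclicBisectionExists.ModpBraidOrbits.gluedHandleChart D i G a (Summit.SmoothPoincare4.SmoothPoincare4.Theorems.AcyclicBisectionExists.ModpBraidOrbits.modelF a κ δ ((b : Metric.closedBall (0 : EuclideanSpace ℝ (Fin 4)) 1) : EuclideanSpace ℝ (Fin 4)))) :=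
  by
  intro B _ _ _ ι _ h X _ _ _ D i bX W _ _ _ bW _ G a κ δ _ _ _ ha hCM hκ hκ2 hδ hδ2 haδ
  exact ⟨isImmersion_handleMap D i G ha hCM hκ hκ2 hδ hδ2 haδ, isEmbedding_handleMap D i G ha hCM hκ hκ2 hδ hδ2 haδ,
    injective_handleMap D i G ha hCM hκ hκ2 hδ hδ2 haδ⟩

end Summit.SmoothPoincare4.SmoothPoincare4.Theorems.AcyclicBisectionExists.ModpBraidOrbits

end
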